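import Literature.Computability.AlgebraicComplexity.GGIL22RestrictedStrength
import Literature.Computability.AlgebraicComplexity.GGIL22SliceRankSubspaces
import Literature.Computability.AlgebraicComplexity.ABV17SingularLocusBound
import HarnessLib

/-!
# Gesmundo–Ghosal–Ikenmeyer–Lysikov 2022, Proposition 6, Corollary 13 (floor) and Proposition 9
# for `GGIL22.sliceRank`: lower bounds for (restricted) strength

Topic `Literature/Computability/AlgebraicComplexity`; third file of the GGIL22 group after
`GGIL22RestrictedStrength.lean` (Definitions 5/8/10, Proposition 11, Theorem 12) and
`GGIL22SliceRankSubspaces.lean` (Proposition 9 in ideal form).  Source: F. Gesmundo, P. Ghosal,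
C. Ikenmeyer, V. Lysikov, *Degree-restricted strength decompositions and algebraic branching programs*,
FSTTCS 2022, arXiv:2205.02149 [GesmundoGhosalIkenmeyerLysikov2022], held text `paper:arxiv-2205.02149`.
Verbatim:

* (p0005 L1–L12) "▶ **Proposition 6.** `str(F) ≥ ⌈½ codim Sing(F)⌉`.  Proof. If `F = Σ_{k=1}^r G_k H_k`,
  then `∂F/∂x_i = Σ G_k ∂H_k/∂x_i + Σ H_k ∂G_k/∂x_i`. Thus all the partial derivatives of `F` lie in the
  ideal `⟨G_1, …, G_r, H_1, …, H_r⟩` and therefore the zero set `Z(G_1, …, H_r)` is contained in `Sing(F)`.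
  Therefore, applying Theorem 1 [Krull], we deduce `codim Sing(F) ≤ codim Z(G_1, …, H_r) ≤ 2r`."
* (p0006 L28–L33) "▶ **Corollary 13** (Kumar's singular locus lower bounds technique). For every
  homogeneous polynomial `F ∈ ℂ[x_0, …, x_n]` of degree `d`, `B_hom(F) ≥ (d−1)⌈½ codim Sing(F)⌉`."
* (p0005 L46–L47) "▶ **Proposition 9.** Let `F` be a homogeneous polynomial. We have `sr(F) ≤ r` if and
  only if `Z(F)` contains a linear subspace of codimension `r`."

## What is proved (no definition, no named fact)

In the tree's height currency for the singular locus, `codim Sing(F) = (singIdeal F).height`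
(`Literature.Computability.AlgebraicComplexity.singIdeal F = (F, ∂F/∂x_i)_i`, file
`ABV17SingularLocusBound.lean`), over a field `K`:
* `GGIL22.height_singIdeal_le_of_eq_sum_mul` — **Proposition 6 (Kumar's ideal)**: if `F = Σ_{i∈ι} p_i q_i`
  with all `p_i, q_i` constant-free then `(singIdeal F).height ≤ 2|ι|` (Leibniz rule + Krull's height
  theorem `Ideal.height_le_card_of_mem_minimalPrimes_span_finset`).  This is a Literature re-homing, with
  credit, of the identical problem-side lemma of
  `Summits/ValiantsHypothesis/ValiantsHypothesis/Theorems/PolyaContinuedLaplaceRigidityStrength.lean`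
  (val-width-17819-w1), which Literature files cannot import.
* `GGIL22.height_singIdeal_le_two_mul_strength` / `…_two_mul_restrictedStrength` — Proposition 6 in the
  vocabulary of `GGIL22.strength` / `GGIL22.restrictedStrength` (`codim Sing F ≤ 2 str(F) ≤ 2 str_j(F)`),
  and the contrapositive engine `GGIL22.lt_restrictedStrength_of_lt_height`
  (`2w < codim Sing F ⇒ w < str_j(F)`).
* `GGIL22.three_le_restrictedStrength_perPoly` — **Corollary 13 at its floor for the permanent**:
  `str_k(per_n) ≥ 3` for `n ≥ 3`, `0 < k < n`, `char K ≠ 2`, from von zur Gathen's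
  `codim Sing(per_n) ≥ 5` (tree: `five_le_height_singIdeal_perPoly`, PROVED); and the CONDITIONAL
  `(4,2)` rung `GGIL22.four_le_restrictedStrength_two_perPoly_four_of_seven_le_height`:
  `codim Sing(per₄) ≥ 7 ⇒ str₂(per₄) ≥ 4` (Alper–Bogart–Velasco report `codim Sing(per₄) = 8` by computer
  algebra; the hypothesis is explicit, nothing is assumed silently), to be read against
  `GGIL22.restrictedStrength_two_detPoly_four_le : str₂(det₄) ≤ 3` (Lampert–Moshkovitz).
* `GGIL22.sliceRank_le_iff_exists_submodule` — **Proposition 9 verbatim for `GGIL22.sliceRank`** over an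
  infinite field: `sr(F) ≤ r ↔ Z(F) ⊇` a linear subspace `W` with `dim W + r ≥ #σ`.

Honest framing: lower-bound tools for the rank-law vocabulary of the `ValiantsHypothesis` line
`laplace_rigidity` (stmt-17819: `LaplaceRigidity ≡ ∀ 0<k<n, C(n,k) ≤ str_k(per_n)`); the singular-locus
method is capped at `codim Sing(per_n) ≤ 2n` (Alper–Bogart–Velasco) and proves nothing near `C(n,k)`;
nothing here bears on `VP ≠ VNP` (NOT proved), and no summit statement is proved in this file.

[cite: GesmundoGhosalIkenmeyerLysikov2022, Proposition 6, Proposition 9, Corollary 13]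
-/

noncomputable section

namespace Literature.Computability.AlgebraicComplexity.GGIL22

open MvPolynomial Finset

variable {K : Type*} [Field K] {σ : Type*}

/-! ### Proposition 6: strength and the singular locus (Kumar's ideal) -/

/-- A homogeneous polynomial of positive degree has no constant term. [folklore] -/
private theorem constantCoeff_eq_zero_of_isHomogeneous {φ : MvPolynomial σ K} {d : ℕ}
    (hφ : φ.IsHomogeneous d) (hd : d ≠ 0) : constantCoeff φ = 0 := by
  rw [constantCoeff_eq]
  exact hφ.coeff_eq_zero (by rw [map_zero]; exact fun h => hd h.symm)

/-- **Kumar's ideal** (Leibniz rule): if `f = Σ_i p_i q_i` then every ideal containing all `p_i` and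
`q_i` contains `f` and all its first partials, i.e. `singIdeal f ≤ I`.
[cite: GesmundoGhosalIkenmeyerLysikov2022, Proposition 6 (proof)] -/
theorem singIdeal_le_of_eq_sum_mul {ι : Type*} [Fintype ι] {f : MvPolynomial σ K}
    (p q : ι → MvPolynomial σ K) (hf : f = ∑ i, p i * q i) (I : Ideal (MvPolynomial σ K))
    (hp : ∀ i, p i ∈ I) (hq : ∀ i, q i ∈ I) : singIdeal f ≤ I := by
  rw [singIdeal_le_iff, hf]
  refine ⟨Ideal.sum_mem _ fun i _ => Ideal.mul_mem_left _ _ (hq i), fun x => ?_⟩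
  rw [map_sum]
  refine Ideal.sum_mem _ fun i _ => ?_
  rw [Derivation.leibniz, smul_eq_mul, smul_eq_mul]
  exact Ideal.add_mem _ (Ideal.mul_mem_right _ _ (hp i)) (Ideal.mul_mem_right _ _ (hq i))

/-- **GGIL22 Proposition 6 in the height currency (`codim Sing(F) ≤ 2r`)**: if `f = Σ_{i ∈ ι} p_i q_i` in
finitely many variables with all `p_i`, `q_i` constant-free, then `(singIdeal f).height ≤ 2|ι|` — the
ideal `(p_i, q_i)_i` is proper, has `≤ 2|ι|` generators and contains `singIdeal f`; Krull's height
theorem.  (Literature re-homing of the identical lemma of the problem-side file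
`…Theorems.PolyaContinuedLaplaceRigidityStrength`, val-width-17819-w1.)
[cite: GesmundoGhosalIkenmeyerLysikov2022, Proposition 6] -/
theorem height_singIdeal_le_of_eq_sum_mul [Finite σ] {ι : Type*} [Fintype ι]
    {f : MvPolynomial σ K} (p q : ι → MvPolynomial σ K) (hf : f = ∑ i, p i * q i)
    (hp : ∀ i, constantCoeff (p i) = 0) (hq : ∀ i, constantCoeff (q i) = 0) :
    (singIdeal f).height ≤ 2 * Fintype.card ι := by
  classical
  haveI : Fintype σ := Fintype.ofFinite σ
  set S : Finset (MvPolynomial σ K) := Finset.univ.image p ∪ Finset.univ.image q with hS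
  set I : Ideal (MvPolynomial σ K) := Ideal.span (S : Set _) with hI
  have hpI : ∀ i, p i ∈ I := fun i => Ideal.subset_span (Finset.mem_coe.2
    (Finset.mem_union_left _ (Finset.mem_image_of_mem p (Finset.mem_univ i))))
  have hqI : ∀ i, q i ∈ I := fun i => Ideal.subset_span (Finset.mem_coe.2
    (Finset.mem_union_right _ (Finset.mem_image_of_mem q (Finset.mem_univ i))))
  have hScard : S.card ≤ 2 * Fintype.card ι :=
    calc S.card ≤ (Finset.univ.image p).card + (Finset.univ.image q).card :=
          Finset.card_union_le _ _
      _ ≤ (Finset.univ : Finset ι).card + (Finset.univ : Finset ι).card :=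
          add_le_add Finset.card_image_le Finset.card_image_le
      _ = 2 * Fintype.card ι := by rw [Finset.card_univ, two_mul]
  have hsing : singIdeal f ≤ I := singIdeal_le_of_eq_sum_mul p q hf I hpI hqI
  -- `I` is proper: all generators lie in the irrelevant ideal `ker constantCoeff`
  have hIker : I ≤ RingHom.ker (constantCoeff : MvPolynomial σ K →+* K) := by
    rw [hI, Ideal.span_le]
    intro g hg
    rw [SetLike.mem_coe, RingHom.mem_ker]
    rw [Finset.mem_coe, hS, Finset.mem_union, Finset.mem_image, Finset.mem_image] at hg
    rcases hg with ⟨i, -, rfl⟩ | ⟨i, -, rfl⟩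
    · exact hp i
    · exact hq i
  have hItop : I ≠ ⊤ := fun htop => RingHom.ker_ne_top _ (top_le_iff.1 (htop ▸ hIker))
  obtain ⟨Q, hQ⟩ := Ideal.nonempty_minimalPrimes hItop
  calc (singIdeal f).height ≤ Q.height := Ideal.height_mono (hsing.trans hQ.1.2)
    _ ≤ S.card := Ideal.height_le_card_of_mem_minimalPrimes_span_finset hQ
    _ ≤ (2 * Fintype.card ι : ℕ) := by exact_mod_cast hScard

/-- **Proposition 6 for a strength decomposition**: `F = Σ_{k<r} G_k H_k` with homogeneous factors of
positive degrees forces `codim Sing(F) ≤ 2r`. [cite: GesmundoGhosalIkenmeyerLysikov2022, Proposition 6] -/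
theorem height_singIdeal_le_of_hasStrengthDecomp [Finite σ] {d r : ℕ} {F : MvPolynomial σ K}
    (h : HasStrengthDecomp d r F) : (singIdeal F).height ≤ 2 * r := by
  obtain ⟨G, H, e, he, hG, hH, hF⟩ := h
  have := height_singIdeal_le_of_eq_sum_mul G H hF
    (fun k => constantCoeff_eq_zero_of_isHomogeneous (hG k) (Nat.pos_iff_ne_zero.1 (he k).1))
    (fun k => constantCoeff_eq_zero_of_isHomogeneous (hH k) (by have := (he k).2; omega))
  rwa [Fintype.card_fin] at this

/-- **Proposition 6 for a `j`-restricted decomposition** (`0 < j < d`): width `r` forces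
`codim Sing(F) ≤ 2r`. [cite: GesmundoGhosalIkenmeyerLysikov2022, Proposition 6] -/
theorem height_singIdeal_le_of_hasRestrictedDecomp [Finite σ] {d j r : ℕ} {F : MvPolynomial σ K}
    (hj : 0 < j) (hjd : j < d) (h : HasRestrictedDecomp d j r F) : (singIdeal F).height ≤ 2 * r :=
  height_singIdeal_le_of_hasStrengthDecomp (hasStrengthDecomp_of_hasRestrictedDecomp hj hjd h)

/-- **GGIL22 Proposition 6, `str(F) ≥ ⌈½ codim Sing(F)⌉`**, in the form `codim Sing(F) ≤ 2·str(F)`, for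
a form `F` of degree `d ≥ 2` (so that strength decompositions exist: the monomial `1`-restricted one).
[cite: GesmundoGhosalIkenmeyerLysikov2022, Proposition 6] -/
theorem height_singIdeal_le_two_mul_strength [Finite σ] {d : ℕ} {F : MvPolynomial σ K}
    (hF : F.IsHomogeneous d) (hd : 2 ≤ d) : (singIdeal F).height ≤ 2 * strength d F := by
  have hne : ({r | HasStrengthDecomp d r F} : Set ℕ).Nonempty :=
    ⟨_, hasStrengthDecomp_of_hasRestrictedDecomp Nat.one_pos (by omega)
      (hasRestrictedDecomp_card_support hF (by omega))⟩
  exact height_singIdeal_le_of_hasStrengthDecomp (Nat.sInf_mem hne)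

/-- Hence `codim Sing(F) ≤ 2·str_j(F)` for `0 < j < d` (Proposition 6 with Proposition 11(a)).
[cite: GesmundoGhosalIkenmeyerLysikov2022, Proposition 6, Proposition 11(a)] -/
theorem height_singIdeal_le_two_mul_restrictedStrength [Finite σ] {d j : ℕ} {F : MvPolynomial σ K}
    (hF : F.IsHomogeneous d) (hj : 0 < j) (hjd : j < d) :
    (singIdeal F).height ≤ 2 * restrictedStrength d j F :=
  height_singIdeal_le_of_hasRestrictedDecomp hj hjd (exists_hasRestrictedDecomp_restrictedStrength hF hjd.le)

/-- **The singular-locus engine, contrapositive**: `2w < codim Sing(F)` forces `w < str_j(F)`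
(`0 < j < d`). [cite: GesmundoGhosalIkenmeyerLysikov2022, Proposition 6, Corollary 13] -/
theorem lt_restrictedStrength_of_lt_height [Finite σ] {d j w : ℕ} {F : MvPolynomial σ K}
    (hF : F.IsHomogeneous d) (hj : 0 < j) (hjd : j < d)
    (h : ((2 * w : ℕ) : ℕ∞) < (singIdeal F).height) : w < restrictedStrength d j F := by
  by_contra hle
  push Not at hle
  have h2 := height_singIdeal_le_two_mul_restrictedStrength hF hj hjd
  have h3 : ((2 * restrictedStrength d j F : ℕ) : ℕ∞) ≤ ((2 * w : ℕ) : ℕ∞) := by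
    exact_mod_cast Nat.mul_le_mul_left 2 hle
  exact absurd (h.trans_le (h2.trans h3)) (lt_irrefl _)

/-! ### Corollary 13 at its floor: the permanent -/

/-- **`str_k(per_n) ≥ 3`** (`n ≥ 3`, `0 < k < n`, `char K ≠ 2`): the permanent is never a sum of two
products of homogeneous factors of degrees `k`, `n − k` — von zur Gathen's `codim Sing(per_n) ≥ 5 > 2·2`
(tree: `five_le_height_singIdeal_perPoly`, PROVED) in the engine of Proposition 6; the floor of
Corollary 13's per-layer bound.  (The method is capped: `codim Sing(per_n) ≤ 2n`, Alper–Bogart–Velasco.)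
[cite: GesmundoGhosalIkenmeyerLysikov2022, Corollary 13 (with Proposition 6)] -/
theorem three_le_restrictedStrength_perPoly (h2 : (2 : K) ≠ 0) {n k : ℕ} (hn : 3 ≤ n) (hk : 0 < k)
    (hkn : k < n) : 3 ≤ restrictedStrength n k (perPoly (Fin n) K) := by
  have hper : (perPoly (Fin n) K).IsHomogeneous n := by
    simpa using perPoly_isHomogeneous (n := Fin n) (k := K)
  refine lt_restrictedStrength_of_lt_height (w := 2) hper hk hkn ?_
  exact lt_of_lt_of_le (by exact_mod_cast (by norm_num : 2 * 2 < 5))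
    (five_le_height_singIdeal_perPoly h2 hn)

/-- **The `(4,2)` rung, conditional form: `codim Sing(per₄) ≥ 7 ⇒ str₂(per₄) ≥ 4`.**  Alper–Bogart–Velasco
2017 (§1) report `codim Sing(per₄) = 8` by computer algebra; that value is NOT in the tree, so the
hypothesis is explicit.  To be read against `restrictedStrength_two_detPoly_four_le : str₂(det₄) ≤ 3`
(Lampert–Moshkovitz 2025): granted the hypothesis, `(n,k) = (4,2)` is the first instance where the
restricted strength separates `per` from `det`. [cite: GesmundoGhosalIkenmeyerLysikov2022, Proposition 6] -/
theorem four_le_restrictedStrength_two_perPoly_four_of_seven_le_height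
    (h7 : (7 : ℕ∞) ≤ (singIdeal (perPoly (Fin 4) K)).height) :
    4 ≤ restrictedStrength 4 2 (perPoly (Fin 4) K) := by
  have hper : (perPoly (Fin 4) K).IsHomogeneous 4 := by
    simpa using perPoly_isHomogeneous (n := Fin 4) (k := K)
  refine lt_restrictedStrength_of_lt_height (w := 3) hper two_pos (by norm_num) ?_
  exact lt_of_lt_of_le (by exact_mod_cast (by norm_num : 2 * 3 < 7)) h7

/-! ### Proposition 9 for `GGIL22.sliceRank` -/

/-- **GGIL22 Proposition 9 (verbatim, for `sliceRank`)**: over an infinite field, a form `F` of degree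
`d ≥ 1` in the variables `σ` has `sr(F) ≤ r` iff `Z(F)` contains a linear subspace of codimension `≤ r`,
i.e. iff `F` vanishes identically on some `W ≤ K^σ` with `dim W + r ≥ #σ`.  (`→`: an optimal slice
decomposition and the common kernel of its linear forms, `exists_linear_iff_exists_submodule`; `←`: the
elementary Nullstellensatz `exists_eq_sum_linear_mul_of_forall_eval_eq_zero` and homogenisation of the
cofactors, `sliceRank_le_of_eq_sum_linear_mul`.) [cite: GesmundoGhosalIkenmeyerLysikov2022, Proposition 9] -/
theorem sliceRank_le_iff_exists_submodule [Fintype σ] [DecidableEq σ] [Infinite K] {d : ℕ}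
    {F : MvPolynomial σ K} (hF : F.IsHomogeneous d) (hd : 1 ≤ d) (r : ℕ) :
    sliceRank d F ≤ r ↔ ∃ W : Submodule K (σ → K), Fintype.card σ ≤ Module.finrank K W + r ∧
      ∀ x ∈ W, eval x F = 0 := by
  constructor
  · intro hr
    obtain ⟨L, H, hL, -, hFeq⟩ := exists_hasRestrictedDecomp_restrictedStrength hF hd (j := 1)
    obtain ⟨W, hW, hWF⟩ := (exists_linear_iff_exists_submodule F (restrictedStrength d 1 F)).mp
      ⟨L, H, hL, hFeq⟩
    exact ⟨W, hW.trans (Nat.add_le_add_left hr _), hWF⟩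
  · rintro ⟨W, hW, hWF⟩
    obtain ⟨L, H, hL, hFeq⟩ := (exists_linear_iff_exists_submodule F r).mpr ⟨W, hW, hWF⟩
    exact sliceRank_le_of_eq_sum_linear_mul hF hd L H hL hFeq

end Literature.Computability.AlgebraicComplexity.GGIL22

end
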